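import Summits.QuantumFields.YangMills.Theorems.ColdStartUniversalityShenZhuZhuW2GeometricErgodicitySU2
import Summits.QuantumFields.YangMills.Theorems.ColdStartUniversalityShenZhuZhuWeightedContractionSU2
import HarnessLib

/-!
# WEIGHTED `W₂` GEOMETRIC ERGODICITY of the `SU(2)` lattice Langevin dynamics on `(ℤ/L)³` — Shen–Zhu–Zhu's Lemma 5.1 AS PRINTED (all initial laws
# `μ, ν ∈ 𝒫(𝒬_L)`), and the VOLUME-FREE cold-start bound `W₂^(ρ_(∞,a)∘torusLift)(δ_Q P_t, μ_(β',L))² ≤ e^(−2κ_a t)·2π²·Σ_(ẽ ∈ E⁺(ℤ³)) a^(−|ẽ|)`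

Seat `ym-line-csu-p1` (g43), route `ColdStartUniversality` of `Summits/QuantumFields/YangMills`, helper file (`--supports stmt-QuantumFields-24809`).
`…ShenZhuZhuWeightedW2ContractionSU2` proved the weighted `W₂` contraction from Dirac initial data; this file passes to arbitrary initial laws exactly as
g42's G66 did for `ρ_L` (Feller continuity makes `(κ_tφ, κ_tψ)` a Kantorovich pair for the cost `e^(−2κt)d_w²`; Kantorovich duality), records the
convergence to the invariant Wilson–Gibbs law, and — the point of the weights — the bound from a deterministic start is UNIFORM IN THE VOLUME for the
torus weights of `ρ_(∞,a)`: `d_w(Q,Q')² ≤ 2π²·Σ_e w_e` and `Σ_e w_e = Σ_(ẽ ∈ E⁺(ℤ³)) a^(−|ẽ|)` does not depend on `L` (the fibres of `torusEdge L` partition `E⁺(ℤ³)`).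
* ★★ `wilson_wW2_pairs_of_coupling`, ★★★ `wilson_szzWasserstein_wW2_contraction_of_initialLaws` — `W₂^(d_w)(νP_t, ν'P_t)² ≤ e^(−2κ_b t) W₂^(d_w)(ν,ν')²`
  (SZZ Lemma 5.1 as printed, for every admissible weight; `κ_b = 1 − (4+6(b²+1)/b)|β'|`);
* ★★★ `wilson_szzWasserstein_wW2_convergence_of_initialLaw` — `W₂^(d_w)(νP_t, μ_(β'))² ≤ e^(−2κ_b t) W₂^(d_w)(ν, μ_(β'))²`;
* ★★ `szzWasserstein_wW2_dirac_le`, `wdistSq_le_sum_weights`, ★★★ `wilson_szzWasserstein_wW2_convergence_dirac` — cold starts: `≤ e^(−2κ_b t)·2π²·Σ_e w_e`;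
* ★★ `sum_torusWeight_eq_tsum` — `Σ_e w_e = Σ_(ẽ) a^(−|ẽ|)` for the torus weights (volume-free);
* ★★★★ `wilson_weightedW2_convergence_dirac_volumeFree` — for `a > 1`, `|β'| < 1/12`, EVERY `L`, every start `Q`, `t > 0`:
  `szzWassersteinSq (ρ_(∞,a)∘torusLift) (κ_t(Q,·)) μ_(β',L) ≤ ofReal(e^(−2(1 − (4+6(a+1)/√a)|β'|)t)·2π²·Σ_(ẽ) a^(−|ẽ|))` — the right-hand side does not see `L`.
THEOREMS ONLY, no definition, no sorry.  HONEST FRAMING: fixed cut-off and fixed coupling (high temperature); "volume-free" = uniform in the torus size `L`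
at FIXED `β'`; nothing `K`-uniform along the route's scaling `β'_K → ∞`; `UniformColdStartMixing` (24809, ASIDE) is not restated; no crux, rung or summit
statement is proved; the Yang–Mills mass gap is NOT proved.
-/

set_option autoImplicit false

noncomputable section

namespace Summit.QuantumFields.YangMills.Theorems.ColdStartUniversality

open MeasureTheory ProbabilityTheory Matrix Complex Finset Filter Topology Set Metric
open scoped BigOperators NNReal ENNReal
open Literature.MathematicalPhysics.QuantumFieldTheory
open Literature.MathematicalPhysics.QuantumLattice (fundamentalRep fundamentalLatticeRep continuous_fundamentalRep fundamentalRep_apply fundamentalLatticeRep_N)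

variable {L : ℕ} [NeZero L]

/-! ## §1. Kantorovich pairs transported by a coupling of the initial laws -/

/-- `Q' ↦ d_w(Q,Q')²` is continuous. [folklore] -/
theorem continuous_wdistSq_right (Q : GaugeConfig 3 L (Matrix.specialUnitaryGroup (Fin 2) ℂ)) (w : Edge 3 L → ℝ) : Continuous fun Q' : GaugeConfig 3 L (Matrix.specialUnitaryGroup (Fin 2) ℂ) => (∑ e : Edge 3 L, w e * (fundamentalLatticeRep 2).riemannDist (Q e) (Q' e) ^ 2) :=
  continuous_finsetSum _ fun e _ => continuous_const.mul (((continuous_riemannDist_two_right (Q e)).comp (continuous_apply e)).pow 2)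

/-- ★★ **Dual pairs under a coupling of the initial laws, weighted cost.**  For continuous `φ, ψ` with `φ(u) + ψ(v) ≤ d_w(u,v)²` and every coupling `q` of
`ν, ν'`:  `∫φ d(κ_t∘ν) + ∫ψ d(κ_t∘ν') ≤ e^(−2κ_b t)·∫ d_w(z₁,z₂)² dq(z)`. [cite: BakryGentilLedoux2014, Thm 9.7.2] [cite: ShenZhuZhuCMP2023, Lemma 5.1] -/
theorem wilson_wW2_pairs_of_coupling (L : ℕ) [NeZero L] (β' b : ℝ) (hb : 1 ≤ b) (hβ : |β'| < 1 / 12) (w : Edge 3 L → ℝ) {m M : ℝ} (hm : 0 < m)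
    (hwm : ∀ e, m ≤ w e) (hwM : ∀ e, w e ≤ M)
    (hwb : ∀ (p : Plaquette 3 L) (e e' : Edge 3 L), e ∈ ({(p.1, p.2.1.1), (p.1.shift p.2.1.1, p.2.1.2), (p.1.shift p.2.1.2, p.2.1.1), (p.1, p.2.1.2)} : Finset (Edge 3 L)) → e' ∈ ({(p.1, p.2.1.1), (p.1.shift p.2.1.1, p.2.1.2), (p.1.shift p.2.1.2, p.2.1.1), (p.1, p.2.1.2)} : Finset (Edge 3 L)) → w e ≤ b ^ 2 * w e')
    (κ : ℝ≥0 → Kernel (GaugeConfig 3 L (Matrix.specialUnitaryGroup (Fin 2) ℂ))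
      (GaugeConfig 3 L (Matrix.specialUnitaryGroup (Fin 2) ℂ))) [∀ t, IsMarkovKernel (κ t)]
    (hreal : ∀ (t : ℝ≥0) (x : GaugeConfig 3 L (Matrix.specialUnitaryGroup (Fin 2) ℂ))
        (Ω : Type) [MeasurableSpace Ω] (P : Measure Ω) [IsProbabilityMeasure P]
        (W : ℝ≥0 → Ω → (Edge 3 L × NoiseIdx 2 → ℝ)) (hW : IsFlatBrownian W P)
        (U : ℝ≥0 → Ω → GaugeConfig 3 L (Matrix.specialUnitaryGroup (Fin 2) ℂ)),
        (∀ ω, U 0 ω = x) →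
        (latticeLangevinDynamics (fundamentalLatticeRep 2) β').IsSolution (fundamentalRep (Fin 2))
          hW.natFiltration P W U →
        κ t x = P.map (U t))
    {t : ℝ≥0} (ht : 0 < (t : ℝ)) {φ ψ : GaugeConfig 3 L (Matrix.specialUnitaryGroup (Fin 2) ℂ) → ℝ} (hφ : Continuous φ) (hψ : Continuous ψ)
    (h : ∀ u v, φ u + ψ v ≤ (∑ e : Edge 3 L, w e * (fundamentalLatticeRep 2).riemannDist (u e) (v e) ^ 2))
    (ν ν' : Measure (GaugeConfig 3 L (Matrix.specialUnitaryGroup (Fin 2) ℂ))) [IsProbabilityMeasure ν] [IsProbabilityMeasure ν']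
    {cpl : Measure (GaugeConfig 3 L (Matrix.specialUnitaryGroup (Fin 2) ℂ) × GaugeConfig 3 L (Matrix.specialUnitaryGroup (Fin 2) ℂ))} (hπ : Literature.Geometry.Riemannian.IsCoupling ν ν' cpl) :
    ∫ y, φ y ∂(κ t ∘ₘ ν) + ∫ y, ψ y ∂(κ t ∘ₘ ν') ≤ Real.exp (-(2 * (1 - (4 + 6 * ((b ^ 2 + 1) / b)) * |β'|) * (t : ℝ))) * ∫ z, (∑ e : Edge 3 L, w e * (fundamentalLatticeRep 2).riemannDist (z.1 e) (z.2 e) ^ 2) ∂cpl := by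
  haveI := borelSpace_config L
  haveI : IsProbabilityMeasure cpl := hπ.1
  haveI : IsProbabilityMeasure (κ t ∘ₘ ν) := by
    constructor; rw [Measure.bind_apply MeasurableSet.univ (κ t).measurable.aemeasurable]; simp
  haveI : IsProbabilityMeasure (κ t ∘ₘ ν') := by
    constructor; rw [Measure.bind_apply MeasurableSet.univ (κ t).measurable.aemeasurable]; simp
  have hκφ : Continuous fun x => ∫ y, φ y ∂(κ t x) := continuous_integral_transitionKernel L β' κ hreal t hφ
  have hκψ : Continuous fun x => ∫ y, ψ y ∂(κ t x) := continuous_integral_transitionKernel L β' κ hreal t hψ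
  have h1 : ∫ y, φ y ∂(κ t ∘ₘ ν) = ∫ z, (∫ y, φ y ∂(κ t z.1)) ∂cpl := by
    rw [Literature.Probability.Process.Harris.integral_comp_measure (κ t) ν
      (hφ.integrable_of_hasCompactSupport (HasCompactSupport.of_compactSpace φ)), ← hπ.2.1, Measure.fst,
      integral_map measurable_fst.aemeasurable (hκφ.aestronglyMeasurable)]
  have h2 : ∫ y, ψ y ∂(κ t ∘ₘ ν') = ∫ z, (∫ y, ψ y ∂(κ t z.2)) ∂cpl := by
    rw [Literature.Probability.Process.Harris.integral_comp_measure (κ t) ν'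
      (hψ.integrable_of_hasCompactSupport (HasCompactSupport.of_compactSpace ψ)), ← hπ.2.2, Measure.snd,
      integral_map measurable_snd.aemeasurable (hκψ.aestronglyMeasurable)]
  have hi1 : Integrable (fun z : GaugeConfig 3 L (Matrix.specialUnitaryGroup (Fin 2) ℂ) × GaugeConfig 3 L (Matrix.specialUnitaryGroup (Fin 2) ℂ) => ∫ y, φ y ∂(κ t z.1)) cpl :=
    (hκφ.comp continuous_fst).integrable_of_hasCompactSupport (HasCompactSupport.of_compactSpace _)
  have hi2 : Integrable (fun z : GaugeConfig 3 L (Matrix.specialUnitaryGroup (Fin 2) ℂ) × GaugeConfig 3 L (Matrix.specialUnitaryGroup (Fin 2) ℂ) => ∫ y, ψ y ∂(κ t z.2)) cpl :=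
    (hκψ.comp continuous_snd).integrable_of_hasCompactSupport (HasCompactSupport.of_compactSpace _)
  have hρi : Integrable (fun z : GaugeConfig 3 L (Matrix.specialUnitaryGroup (Fin 2) ℂ) × GaugeConfig 3 L (Matrix.specialUnitaryGroup (Fin 2) ℂ) => (∑ e : Edge 3 L, w e * (fundamentalLatticeRep 2).riemannDist (z.1 e) (z.2 e) ^ 2)) cpl :=
    (continuous_wdistSq w).integrable_of_hasCompactSupport (HasCompactSupport.of_compactSpace _)
  rw [h1, h2, ← integral_add hi1 hi2, ← integral_const_mul]
  refine integral_mono (hi1.add hi2) (hρi.const_mul _) fun z => ?_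
  exact wilson_wkuwada_pairs L β' b hb hβ w hm hwm hwM hwb κ hreal ht hφ hψ h z.1 z.2

/-! ## §2. Shen–Zhu–Zhu's Lemma 5.1 as printed: all initial laws -/

/-- ★★★ **Weighted `W₂` contraction for arbitrary initial laws** — Shen–Zhu–Zhu's Lemma 5.1 in its printed form `W₂(μP_t, νP_t) ≤ e^(−K̃t)W₂(μ,ν)`,
`μ, ν ∈ 𝒫(𝒬_L)`, for the torus form `d_w` of the weighted distance and every admissible weight (`b ≥ 1`, `0 < m ≤ w ≤ M`, plaquette ratio `≤ b²`):
`szzWassersteinSq d_w² (κ_t∘ν) (κ_t∘ν') ≤ ofReal(e^(−2κ_b t))·szzWassersteinSq d_w² ν ν'`, `κ_b = 1 − (4+6(b²+1)/b)|β'|`.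
[cite: ShenZhuZhuCMP2023, Lemma 5.1] [cite: Villani2003, Thm. 1.3] -/
theorem wilson_szzWasserstein_wW2_contraction_of_initialLaws (L : ℕ) [NeZero L]
    (ν ν' : Measure (GaugeConfig 3 L (Matrix.specialUnitaryGroup (Fin 2) ℂ))) [IsProbabilityMeasure ν] [IsProbabilityMeasure ν'] (β' b : ℝ) (hb : 1 ≤ b) (hβ : |β'| < 1 / 12)
    (w : Edge 3 L → ℝ) {m M : ℝ} (hm : 0 < m) (hwm : ∀ e, m ≤ w e) (hwM : ∀ e, w e ≤ M)
    (hwb : ∀ (p : Plaquette 3 L) (e e' : Edge 3 L), e ∈ ({(p.1, p.2.1.1), (p.1.shift p.2.1.1, p.2.1.2), (p.1.shift p.2.1.2, p.2.1.1), (p.1, p.2.1.2)} : Finset (Edge 3 L)) → e' ∈ ({(p.1, p.2.1.1), (p.1.shift p.2.1.1, p.2.1.2), (p.1.shift p.2.1.2, p.2.1.1), (p.1, p.2.1.2)} : Finset (Edge 3 L)) → w e ≤ b ^ 2 * w e')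
    (κ : ℝ≥0 → Kernel (GaugeConfig 3 L (Matrix.specialUnitaryGroup (Fin 2) ℂ))
      (GaugeConfig 3 L (Matrix.specialUnitaryGroup (Fin 2) ℂ))) [∀ t, IsMarkovKernel (κ t)]
    (hreal : ∀ (t : ℝ≥0) (x : GaugeConfig 3 L (Matrix.specialUnitaryGroup (Fin 2) ℂ))
        (Ω : Type) [MeasurableSpace Ω] (P : Measure Ω) [IsProbabilityMeasure P]
        (W : ℝ≥0 → Ω → (Edge 3 L × NoiseIdx 2 → ℝ)) (hW : IsFlatBrownian W P)
        (U : ℝ≥0 → Ω → GaugeConfig 3 L (Matrix.specialUnitaryGroup (Fin 2) ℂ)),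
        (∀ ω, U 0 ω = x) →
        (latticeLangevinDynamics (fundamentalLatticeRep 2) β').IsSolution (fundamentalRep (Fin 2))
          hW.natFiltration P W U →
        κ t x = P.map (U t))
    {t : ℝ≥0} (ht : 0 < (t : ℝ)) :
    szzWassersteinSq (fun U U' : GaugeConfig 3 L (Matrix.specialUnitaryGroup (Fin 2) ℂ) => (∑ e : Edge 3 L, w e * (fundamentalLatticeRep 2).riemannDist (U e) (U' e) ^ 2)) (κ t ∘ₘ ν) (κ t ∘ₘ ν') ≤
      ENNReal.ofReal (Real.exp (-(2 * (1 - (4 + 6 * ((b ^ 2 + 1) / b)) * |β'|) * (t : ℝ)))) * szzWassersteinSq (fun U U' : GaugeConfig 3 L (Matrix.specialUnitaryGroup (Fin 2) ℂ) => (∑ e : Edge 3 L, w e * (fundamentalLatticeRep 2).riemannDist (U e) (U' e) ^ 2)) ν ν' := by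
  classical
  haveI := secondCountableTopology_su2
  haveI := borelSpace_config L
  haveI : IsProbabilityMeasure (κ t ∘ₘ ν) := by
    constructor; rw [Measure.bind_apply MeasurableSet.univ (κ t).measurable.aemeasurable]; simp
  haveI : IsProbabilityMeasure (κ t ∘ₘ ν') := by
    constructor; rw [Measure.bind_apply MeasurableSet.univ (κ t).measurable.aemeasurable]; simp
  have hw : ∀ e, 0 < w e := fun e => hm.trans_le (hwm e)
  have hnn : ∀ u v : GaugeConfig 3 L (Matrix.specialUnitaryGroup (Fin 2) ℂ), 0 ≤ (∑ e : Edge 3 L, w e * (fundamentalLatticeRep 2).riemannDist (u e) (v e) ^ 2) := fun u v => Finset.sum_nonneg fun e _ => mul_nonneg (hw e).le (sq_nonneg _)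
  have hzero : ∀ u v : GaugeConfig 3 L (Matrix.specialUnitaryGroup (Fin 2) ℂ), Real.sqrt (∑ e : Edge 3 L, w e * (fundamentalLatticeRep 2).riemannDist (u e) (v e) ^ 2) = 0 ↔ u = v := fun u v => by
    rw [Real.sqrt_eq_zero (hnn u v), wdistSq_eq_zero_iff u v w hw]
  have hself : ∀ u : GaugeConfig 3 L (Matrix.specialUnitaryGroup (Fin 2) ℂ), Real.sqrt (∑ e : Edge 3 L, w e * (fundamentalLatticeRep 2).riemannDist (u e) (u e) ^ 2) = 0 := fun u => (hzero u u).2 rfl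
  have hcomm : ∀ u v : GaugeConfig 3 L (Matrix.specialUnitaryGroup (Fin 2) ℂ), Real.sqrt (∑ e : Edge 3 L, w e * (fundamentalLatticeRep 2).riemannDist (u e) (v e) ^ 2) = Real.sqrt (∑ e : Edge 3 L, w e * (fundamentalLatticeRep 2).riemannDist (v e) (u e) ^ 2) := fun u v => by rw [wdistSq_comm u v w]
  have htri : ∀ u v z : GaugeConfig 3 L (Matrix.specialUnitaryGroup (Fin 2) ℂ), Real.sqrt (∑ e : Edge 3 L, w e * (fundamentalLatticeRep 2).riemannDist (u e) (z e) ^ 2) ≤ Real.sqrt (∑ e : Edge 3 L, w e * (fundamentalLatticeRep 2).riemannDist (u e) (v e) ^ 2) + Real.sqrt (∑ e : Edge 3 L, w e * (fundamentalLatticeRep 2).riemannDist (v e) (z e) ^ 2) :=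
    fun u v z => wdist_triangle u v z w fun e => (hw e).le
  have hcont2 : Continuous fun p : GaugeConfig 3 L (Matrix.specialUnitaryGroup (Fin 2) ℂ) × GaugeConfig 3 L (Matrix.specialUnitaryGroup (Fin 2) ℂ) => (∑ e : Edge 3 L, w e * (fundamentalLatticeRep 2).riemannDist (p.1 e) (p.2 e) ^ 2) := continuous_wdistSq w
  letI : MetricSpace (GaugeConfig 3 L (Matrix.specialUnitaryGroup (Fin 2) ℂ)) :=
    { __ := PseudoMetricSpace.ofDistTopology (fun u v : GaugeConfig 3 L (Matrix.specialUnitaryGroup (Fin 2) ℂ) => Real.sqrt (∑ e : Edge 3 L, w e * (fundamentalLatticeRep 2).riemannDist (u e) (v e) ^ 2)) hself hcomm htri (isOpen_iff_wdist_ball w hm hwm hwM),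
      eq_of_dist_eq_zero := fun {u v} huv => (hzero u v).1 huv }
  let c : C(GaugeConfig 3 L (Matrix.specialUnitaryGroup (Fin 2) ℂ) × GaugeConfig 3 L (Matrix.specialUnitaryGroup (Fin 2) ℂ), ℝ) := ⟨fun p => (∑ e : Edge 3 L, w e * (fundamentalLatticeRep 2).riemannDist (p.1 e) (p.2 e) ^ 2), hcont2⟩
  obtain ⟨π, hπ, hlub⟩ := Literature.MeasureTheory.OptimalTransport.exists_isCoupling_isLUB_integral (μ := κ t ∘ₘ ν) (ν := κ t ∘ₘ ν')
    (by rw [measure_univ, measure_univ]) c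
  have hprob : IsProbabilityMeasure π := by
    constructor
    have h1 : π.map Prod.fst Set.univ = 1 := by rw [hπ.map_fst]; exact measure_univ
    rwa [Measure.map_apply measurable_fst MeasurableSet.univ, Set.preimage_univ] at h1
  haveI := hprob
  have hπ' : Literature.Geometry.Riemannian.IsCoupling (κ t ∘ₘ ν) (κ t ∘ₘ ν') π := ⟨hprob, hπ.map_fst, hπ.map_snd⟩
  have hρi : Integrable (fun z : GaugeConfig 3 L (Matrix.specialUnitaryGroup (Fin 2) ℂ) × GaugeConfig 3 L (Matrix.specialUnitaryGroup (Fin 2) ℂ) => (∑ e : Edge 3 L, w e * (fundamentalLatticeRep 2).riemannDist (z.1 e) (z.2 e) ^ 2)) π := hcont2.integrable_of_hasCompactSupport (HasCompactSupport.of_compactSpace _)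
  have hlhs : szzWassersteinSq (fun U U' : GaugeConfig 3 L (Matrix.specialUnitaryGroup (Fin 2) ℂ) => (∑ e : Edge 3 L, w e * (fundamentalLatticeRep 2).riemannDist (U e) (U' e) ^ 2)) (κ t ∘ₘ ν) (κ t ∘ₘ ν') ≤ ENNReal.ofReal (∫ z, c z ∂π) := by
    calc szzWassersteinSq (fun U U' : GaugeConfig 3 L (Matrix.specialUnitaryGroup (Fin 2) ℂ) => (∑ e : Edge 3 L, w e * (fundamentalLatticeRep 2).riemannDist (U e) (U' e) ^ 2)) (κ t ∘ₘ ν) (κ t ∘ₘ ν')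
        ≤ ∫⁻ z, ENNReal.ofReal ((∑ e : Edge 3 L, w e * (fundamentalLatticeRep 2).riemannDist (z.1 e) (z.2 e) ^ 2)) ∂π := szzWassersteinSq_le _ hπ'
      _ = ENNReal.ofReal (∫ z, (∑ e : Edge 3 L, w e * (fundamentalLatticeRep 2).riemannDist (z.1 e) (z.2 e) ^ 2) ∂π) := (ofReal_integral_eq_lintegral_ofReal hρi (ae_of_all _ fun z => hnn z.1 z.2)).symm
      _ = ENNReal.ofReal (∫ z, c z ∂π) := rfl
  obtain ⟨ar, har⟩ : ∃ ar : ℝ, ar = Real.exp (-(2 * (1 - (4 + 6 * ((b ^ 2 + 1) / b)) * |β'|) * (t : ℝ))) := ⟨_, rfl⟩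
  have ha0 : 0 < ar := by rw [har]; exact Real.exp_pos _
  rw [← har]
  refine hlhs.trans ?_
  unfold szzWassersteinSq
  rw [ENNReal.mul_iInf_of_ne (ENNReal.ofReal_pos.2 ha0).ne' ENNReal.ofReal_ne_top]
  refine le_iInf fun q => ?_
  haveI := q.2.1
  have hρq : Integrable (fun z : GaugeConfig 3 L (Matrix.specialUnitaryGroup (Fin 2) ℂ) × GaugeConfig 3 L (Matrix.specialUnitaryGroup (Fin 2) ℂ) => (∑ e : Edge 3 L, w e * (fundamentalLatticeRep 2).riemannDist (z.1 e) (z.2 e) ^ 2)) (q : Measure _) := hcont2.integrable_of_hasCompactSupport (HasCompactSupport.of_compactSpace _)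
  have hub : ar * ∫ z : GaugeConfig 3 L (Matrix.specialUnitaryGroup (Fin 2) ℂ) × GaugeConfig 3 L (Matrix.specialUnitaryGroup (Fin 2) ℂ), (∑ e : Edge 3 L, w e * (fundamentalLatticeRep 2).riemannDist (z.1 e) (z.2 e) ^ 2) ∂(q : Measure _) ∈
      upperBounds (Literature.MeasureTheory.OptimalTransport.dualValues (κ t ∘ₘ ν) (κ t ∘ₘ ν') c) := by
    rintro r ⟨φ, ψ, hφψ, rfl⟩
    rw [har]
    exact wilson_wW2_pairs_of_coupling L β' b hb hβ w hm hwm hwM hwb κ hreal ht φ.continuous ψ.continuous (fun u v => hφψ u v) ν ν' q.2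
  have hcost : ∫ z, c z ∂π ≤ ar * ∫ z : GaugeConfig 3 L (Matrix.specialUnitaryGroup (Fin 2) ℂ) × GaugeConfig 3 L (Matrix.specialUnitaryGroup (Fin 2) ℂ), (∑ e : Edge 3 L, w e * (fundamentalLatticeRep 2).riemannDist (z.1 e) (z.2 e) ^ 2) ∂(q : Measure _) := hlub.2 hub
  rw [← ofReal_integral_eq_lintegral_ofReal hρq (ae_of_all _ fun z => hnn z.1 z.2), ← ENNReal.ofReal_mul ha0.le]
  exact ENNReal.ofReal_le_ofReal hcost

/-! ## §3. Convergence to the Wilson–Gibbs law in the weighted distance -/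

/-- ★★★ **Weighted `W₂` convergence to equilibrium from every initial law**: `W₂^(d_w)(νP_t, μ_(β'))² ≤ e^(−2κ_b t)·W₂^(d_w)(ν, μ_(β'))²` (`μ_(β')` is
invariant under every realising kernel). [cite: ShenZhuZhuCMP2023, Lemma 5.1] -/
theorem wilson_szzWasserstein_wW2_convergence_of_initialLaw (L : ℕ) [NeZero L]
    (ν : Measure (GaugeConfig 3 L (Matrix.specialUnitaryGroup (Fin 2) ℂ))) [IsProbabilityMeasure ν] (β' b : ℝ) (hb : 1 ≤ b) (hβ : |β'| < 1 / 12)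
    (w : Edge 3 L → ℝ) {m M : ℝ} (hm : 0 < m) (hwm : ∀ e, m ≤ w e) (hwM : ∀ e, w e ≤ M)
    (hwb : ∀ (p : Plaquette 3 L) (e e' : Edge 3 L), e ∈ ({(p.1, p.2.1.1), (p.1.shift p.2.1.1, p.2.1.2), (p.1.shift p.2.1.2, p.2.1.1), (p.1, p.2.1.2)} : Finset (Edge 3 L)) → e' ∈ ({(p.1, p.2.1.1), (p.1.shift p.2.1.1, p.2.1.2), (p.1.shift p.2.1.2, p.2.1.1), (p.1, p.2.1.2)} : Finset (Edge 3 L)) → w e ≤ b ^ 2 * w e')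
    (κ : ℝ≥0 → Kernel (GaugeConfig 3 L (Matrix.specialUnitaryGroup (Fin 2) ℂ))
      (GaugeConfig 3 L (Matrix.specialUnitaryGroup (Fin 2) ℂ))) [∀ t, IsMarkovKernel (κ t)]
    (hreal : ∀ (t : ℝ≥0) (x : GaugeConfig 3 L (Matrix.specialUnitaryGroup (Fin 2) ℂ))
        (Ω : Type) [MeasurableSpace Ω] (P : Measure Ω) [IsProbabilityMeasure P]
        (W : ℝ≥0 → Ω → (Edge 3 L × NoiseIdx 2 → ℝ)) (hW : IsFlatBrownian W P)
        (U : ℝ≥0 → Ω → GaugeConfig 3 L (Matrix.specialUnitaryGroup (Fin 2) ℂ)),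
        (∀ ω, U 0 ω = x) →
        (latticeLangevinDynamics (fundamentalLatticeRep 2) β').IsSolution (fundamentalRep (Fin 2))
          hW.natFiltration P W U →
        κ t x = P.map (U t))
    {t : ℝ≥0} (ht : 0 < (t : ℝ)) :
    szzWassersteinSq (fun U U' : GaugeConfig 3 L (Matrix.specialUnitaryGroup (Fin 2) ℂ) => (∑ e : Edge 3 L, w e * (fundamentalLatticeRep 2).riemannDist (U e) (U' e) ^ 2)) (κ t ∘ₘ ν) (wilsonMeasure (d := 3) (L := L) (fundamentalRep (Fin 2)) β') ≤
      ENNReal.ofReal (Real.exp (-(2 * (1 - (4 + 6 * ((b ^ 2 + 1) / b)) * |β'|) * (t : ℝ)))) * szzWassersteinSq (fun U U' : GaugeConfig 3 L (Matrix.specialUnitaryGroup (Fin 2) ℂ) => (∑ e : Edge 3 L, w e * (fundamentalLatticeRep 2).riemannDist (U e) (U' e) ^ 2)) ν (wilsonMeasure (d := 3) (L := L) (fundamentalRep (Fin 2)) β') := by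
  haveI : IsProbabilityMeasure (wilsonMeasure (d := 3) (L := L) (fundamentalRep (Fin 2)) β') :=
    isProbabilityMeasure_wilsonMeasure (d := 3) (L := L) (fundamentalRep (Fin 2)) (continuous_fundamentalRep (Fin 2)) β'
  have hinv : (wilsonMeasure (d := 3) (L := L) (fundamentalRep (Fin 2)) β').bind (κ t) = (wilsonMeasure (d := 3) (L := L) (fundamentalRep (Fin 2)) β') :=
    (wilson_invariant_of_fact L β' (wilsonMeasureLangevinInvariant_su2 L β') κ hreal t).def
  have h := wilson_szzWasserstein_wW2_contraction_of_initialLaws L ν (wilsonMeasure (d := 3) (L := L) (fundamentalRep (Fin 2)) β') β' b hb hβ w hm hwm hwM hwb κ hreal ht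
  rw [hinv] at h
  exact h

/-- ★★ **`W₂^(d_w)(δ_Q, μ)² ≤ ∫ d_w(Q,·)² dμ`** (product coupling). [folklore] -/
theorem szzWasserstein_wW2_dirac_le (Q : GaugeConfig 3 L (Matrix.specialUnitaryGroup (Fin 2) ℂ)) (w : Edge 3 L → ℝ) (hw : ∀ e, 0 ≤ w e) (μ : Measure (GaugeConfig 3 L (Matrix.specialUnitaryGroup (Fin 2) ℂ))) [IsProbabilityMeasure μ] :
    szzWassersteinSq (fun U U' : GaugeConfig 3 L (Matrix.specialUnitaryGroup (Fin 2) ℂ) => (∑ e : Edge 3 L, w e * (fundamentalLatticeRep 2).riemannDist (U e) (U' e) ^ 2)) (Measure.dirac Q) μ ≤ ENNReal.ofReal (∫ Q', (∑ e : Edge 3 L, w e * (fundamentalLatticeRep 2).riemannDist (Q e) (Q' e) ^ 2) ∂μ) := by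
  haveI := secondCountableTopology_su2
  haveI := borelSpace_config L
  have hc := Literature.Geometry.Riemannian.isCoupling_prod (Measure.dirac Q) μ
  have hnn : ∀ Q' : GaugeConfig 3 L (Matrix.specialUnitaryGroup (Fin 2) ℂ), 0 ≤ (∑ e : Edge 3 L, w e * (fundamentalLatticeRep 2).riemannDist (Q e) (Q' e) ^ 2) := fun Q' => Finset.sum_nonneg fun e _ => mul_nonneg (hw e) (sq_nonneg _)
  have hρc : Continuous fun Q' : GaugeConfig 3 L (Matrix.specialUnitaryGroup (Fin 2) ℂ) => (∑ e : Edge 3 L, w e * (fundamentalLatticeRep 2).riemannDist (Q e) (Q' e) ^ 2) := continuous_wdistSq_right Q w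
  have hρi : Integrable (fun Q' : GaugeConfig 3 L (Matrix.specialUnitaryGroup (Fin 2) ℂ) => (∑ e : Edge 3 L, w e * (fundamentalLatticeRep 2).riemannDist (Q e) (Q' e) ^ 2)) μ := hρc.integrable_of_hasCompactSupport (HasCompactSupport.of_compactSpace _)
  calc szzWassersteinSq (fun U U' : GaugeConfig 3 L (Matrix.specialUnitaryGroup (Fin 2) ℂ) => (∑ e : Edge 3 L, w e * (fundamentalLatticeRep 2).riemannDist (U e) (U' e) ^ 2)) (Measure.dirac Q) μ
      ≤ ∫⁻ z, ENNReal.ofReal ((∑ e : Edge 3 L, w e * (fundamentalLatticeRep 2).riemannDist (z.1 e) (z.2 e) ^ 2)) ∂((Measure.dirac Q).prod μ) := szzWassersteinSq_le _ hc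
    _ ≤ ∫⁻ Q', ENNReal.ofReal ((∑ e : Edge 3 L, w e * (fundamentalLatticeRep 2).riemannDist (Q e) (Q' e) ^ 2)) ∂μ := by
        rw [Measure.dirac_prod]
        exact lintegral_map_le _ _
    _ = ENNReal.ofReal (∫ Q', (∑ e : Edge 3 L, w e * (fundamentalLatticeRep 2).riemannDist (Q e) (Q' e) ^ 2) ∂μ) := (ofReal_integral_eq_lintegral_ofReal hρi (ae_of_all _ hnn)).symm

/-- `d_w(Q,Q')² ≤ 2π²·Σ_e w_e` (each link of `SU(2)` has diameter `√2·π`). [cite: GallotHulinLafontaine2004, 2.91] -/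
theorem wdistSq_le_sum_weights (Q Q' : GaugeConfig 3 L (Matrix.specialUnitaryGroup (Fin 2) ℂ)) (w : Edge 3 L → ℝ) (hw : ∀ e, 0 ≤ w e) :
    (∑ e : Edge 3 L, w e * (fundamentalLatticeRep 2).riemannDist (Q e) (Q' e) ^ 2) ≤ 2 * Real.pi ^ 2 * ∑ e : Edge 3 L, w e := by
  rw [Finset.mul_sum]
  refine Finset.sum_le_sum fun e _ => ?_
  have h0 := (fundamentalLatticeRep 2).riemannDist_nonneg (Q e) (Q' e)
  have h1 : (fundamentalLatticeRep 2).riemannDist (Q e) (Q' e) ≤ Real.sqrt 2 * Real.pi := riemannDist_two_le _ _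
  have h2 : (fundamentalLatticeRep 2).riemannDist (Q e) (Q' e) ^ 2 ≤ (Real.sqrt 2 * Real.pi) ^ 2 := pow_le_pow_left₀ h0 h1 2
  rw [mul_pow, Real.sq_sqrt (by norm_num)] at h2
  calc w e * (fundamentalLatticeRep 2).riemannDist (Q e) (Q' e) ^ 2 ≤ w e * (2 * Real.pi ^ 2) := mul_le_mul_of_nonneg_left h2 (hw e)
    _ = 2 * Real.pi ^ 2 * w e := by ring

/-- ★★★ **Weighted `W₂` geometric ergodicity from a cold start**: `W₂^(d_w)(κ_t(Q,·), μ_(β'))² ≤ e^(−2κ_b t)·2π²·Σ_e w_e` for every deterministic start `Q`.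
[cite: ShenZhuZhuCMP2023, Lemma 5.1] -/
theorem wilson_szzWasserstein_wW2_convergence_dirac (L : ℕ) [NeZero L] (Q : GaugeConfig 3 L (Matrix.specialUnitaryGroup (Fin 2) ℂ)) (β' b : ℝ) (hb : 1 ≤ b) (hβ : |β'| < 1 / 12)
    (w : Edge 3 L → ℝ) {m M : ℝ} (hm : 0 < m) (hwm : ∀ e, m ≤ w e) (hwM : ∀ e, w e ≤ M)
    (hwb : ∀ (p : Plaquette 3 L) (e e' : Edge 3 L), e ∈ ({(p.1, p.2.1.1), (p.1.shift p.2.1.1, p.2.1.2), (p.1.shift p.2.1.2, p.2.1.1), (p.1, p.2.1.2)} : Finset (Edge 3 L)) → e' ∈ ({(p.1, p.2.1.1), (p.1.shift p.2.1.1, p.2.1.2), (p.1.shift p.2.1.2, p.2.1.1), (p.1, p.2.1.2)} : Finset (Edge 3 L)) → w e ≤ b ^ 2 * w e')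
    (κ : ℝ≥0 → Kernel (GaugeConfig 3 L (Matrix.specialUnitaryGroup (Fin 2) ℂ))
      (GaugeConfig 3 L (Matrix.specialUnitaryGroup (Fin 2) ℂ))) [∀ t, IsMarkovKernel (κ t)]
    (hreal : ∀ (t : ℝ≥0) (x : GaugeConfig 3 L (Matrix.specialUnitaryGroup (Fin 2) ℂ))
        (Ω : Type) [MeasurableSpace Ω] (P : Measure Ω) [IsProbabilityMeasure P]
        (W : ℝ≥0 → Ω → (Edge 3 L × NoiseIdx 2 → ℝ)) (hW : IsFlatBrownian W P)
        (U : ℝ≥0 → Ω → GaugeConfig 3 L (Matrix.specialUnitaryGroup (Fin 2) ℂ)),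
        (∀ ω, U 0 ω = x) →
        (latticeLangevinDynamics (fundamentalLatticeRep 2) β').IsSolution (fundamentalRep (Fin 2))
          hW.natFiltration P W U →
        κ t x = P.map (U t))
    {t : ℝ≥0} (ht : 0 < (t : ℝ)) :
    szzWassersteinSq (fun U U' : GaugeConfig 3 L (Matrix.specialUnitaryGroup (Fin 2) ℂ) => (∑ e : Edge 3 L, w e * (fundamentalLatticeRep 2).riemannDist (U e) (U' e) ^ 2)) (κ t Q) (wilsonMeasure (d := 3) (L := L) (fundamentalRep (Fin 2)) β') ≤
      ENNReal.ofReal (Real.exp (-(2 * (1 - (4 + 6 * ((b ^ 2 + 1) / b)) * |β'|) * (t : ℝ))) * (2 * Real.pi ^ 2 * ∑ e : Edge 3 L, w e)) := by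
  haveI : IsProbabilityMeasure (wilsonMeasure (d := 3) (L := L) (fundamentalRep (Fin 2)) β') :=
    isProbabilityMeasure_wilsonMeasure (d := 3) (L := L) (fundamentalRep (Fin 2)) (continuous_fundamentalRep (Fin 2)) β'
  haveI := borelSpace_config L
  have hw : ∀ e, 0 ≤ w e := fun e => (hm.trans_le (hwm e)).le
  have hbind : κ t ∘ₘ Measure.dirac Q = κ t Q := by rw [Measure.dirac_bind (κ t).measurable]
  have h := wilson_szzWasserstein_wW2_convergence_of_initialLaw L (Measure.dirac Q) β' b hb hβ w hm hwm hwM hwb κ hreal ht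
  rw [hbind] at h
  rw [ENNReal.ofReal_mul (Real.exp_pos _).le]
  refine h.trans (mul_le_mul' le_rfl ((szzWasserstein_wW2_dirac_le Q w hw (wilsonMeasure (d := 3) (L := L) (fundamentalRep (Fin 2)) β')).trans (ENNReal.ofReal_le_ofReal ?_)))
  have hρc : Continuous fun Q' : GaugeConfig 3 L (Matrix.specialUnitaryGroup (Fin 2) ℂ) => (∑ e : Edge 3 L, w e * (fundamentalLatticeRep 2).riemannDist (Q e) (Q' e) ^ 2) := continuous_wdistSq_right Q w
  have hρi : Integrable (fun Q' : GaugeConfig 3 L (Matrix.specialUnitaryGroup (Fin 2) ℂ) => (∑ e : Edge 3 L, w e * (fundamentalLatticeRep 2).riemannDist (Q e) (Q' e) ^ 2)) (wilsonMeasure (d := 3) (L := L) (fundamentalRep (Fin 2)) β') := hρc.integrable_of_hasCompactSupport (HasCompactSupport.of_compactSpace _)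
  calc ∫ Q', (∑ e : Edge 3 L, w e * (fundamentalLatticeRep 2).riemannDist (Q e) (Q' e) ^ 2) ∂(wilsonMeasure (d := 3) (L := L) (fundamentalRep (Fin 2)) β') ≤ ∫ _Q', (2 * Real.pi ^ 2 * ∑ e : Edge 3 L, w e) ∂(wilsonMeasure (d := 3) (L := L) (fundamentalRep (Fin 2)) β') :=
        integral_mono hρi (integrable_const _) fun Q' => wdistSq_le_sum_weights Q Q' w hw
    _ = 2 * Real.pi ^ 2 * ∑ e : Edge 3 L, w e := by rw [integral_const, probReal_univ, one_smul]

/-! ## §4. The torus weights of `ρ_(∞,a)`: the total weight is volume-free -/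

/-- ★★ **`Σ_e w_e = Σ_(ẽ ∈ E⁺(ℤ³)) a^(−|ẽ|)` for the torus weights** `w_e = Σ_(torusEdge ẽ = e) a^(−|ẽ|)`: the fibres of `torusEdge L` partition the edges
of `ℤ³`, so the total weight does not depend on the torus size `L`. [cite: ShenZhuZhuCMP2023, (1.4)] -/
theorem sum_torusWeight_eq_tsum {a : ℝ} (ha : 1 < a) :
    ∑ e : Edge 3 L, (∑' et : {et : Literature.MathematicalPhysics.QuantumLattice.ZdEdge 3 // Literature.MathematicalPhysics.QuantumLattice.torusEdge L et = e}, (a ^ edgeLevel et.1)⁻¹) = ∑' et : Literature.MathematicalPhysics.QuantumLattice.ZdEdge 3, (a ^ edgeLevel et)⁻¹ := by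
  classical
  obtain ⟨F, hF⟩ : ∃ F : Literature.MathematicalPhysics.QuantumLattice.ZdEdge 3 → ℝ, F = fun et => (a ^ edgeLevel et)⁻¹ := ⟨_, rfl⟩
  have hS : Summable F := by rw [hF]; exact summable_inv_pow_edgeLevel ha
  rw [show (fun et : Literature.MathematicalPhysics.QuantumLattice.ZdEdge 3 => (a ^ edgeLevel et)⁻¹) = F from hF.symm]
  have h1 : ∑' et, F et = ∑' q : (Σ e : Edge 3 L, {et : Literature.MathematicalPhysics.QuantumLattice.ZdEdge 3 // Literature.MathematicalPhysics.QuantumLattice.torusEdge L et = e}), F q.2.1 :=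
    (Equiv.tsum_eq (Equiv.sigmaFiberEquiv (Literature.MathematicalPhysics.QuantumLattice.torusEdge L)) F).symm
  have h2 : ∑' q : (Σ e : Edge 3 L, {et : Literature.MathematicalPhysics.QuantumLattice.ZdEdge 3 // Literature.MathematicalPhysics.QuantumLattice.torusEdge L et = e}), F q.2.1 = ∑' e : Edge 3 L, ∑' et : {et : Literature.MathematicalPhysics.QuantumLattice.ZdEdge 3 // Literature.MathematicalPhysics.QuantumLattice.torusEdge L et = e}, F et.1 :=
    Summable.tsum_sigma' (fun e => hS.subtype _) ((Equiv.summable_iff (Equiv.sigmaFiberEquiv (Literature.MathematicalPhysics.QuantumLattice.torusEdge L))).2 hS)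
  rw [h1, h2, tsum_fintype]
  refine Finset.sum_congr rfl fun e _ => ?_
  rw [hF]

/-- ★★★★ **VOLUME-FREE weighted `W₂` ergodicity from every cold start.**  For `a > 1`, `|β'| < 1/12`, EVERY torus size `L`, every deterministic start
`Q`, every realising kernel family and `t > 0`:
`szzWassersteinSq (ρ_(∞,a)∘torusLift)² (κ_t(Q,·)) μ_(β',L) ≤ ofReal(e^(−2(1 − (4+6(√a²+1)/√a)|β'|)t) · 2π² · Σ_(ẽ ∈ E⁺(ℤ³)) a^(−|ẽ|))` — the right-hand side
is independent of `L` (Shen–Zhu–Zhu's mechanism for the infinite-volume limit, Theorem 1.2, at the level of the finite-volume dynamics).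
[cite: ShenZhuZhuCMP2023, Lemma 5.1] -/
theorem wilson_weightedW2_convergence_dirac_volumeFree (L : ℕ) [NeZero L] (Q : GaugeConfig 3 L (Matrix.specialUnitaryGroup (Fin 2) ℂ)) (β' : ℝ) (hβ : |β'| < 1 / 12) {a : ℝ} (ha : 1 < a)
    (κ : ℝ≥0 → Kernel (GaugeConfig 3 L (Matrix.specialUnitaryGroup (Fin 2) ℂ))
      (GaugeConfig 3 L (Matrix.specialUnitaryGroup (Fin 2) ℂ))) [∀ t, IsMarkovKernel (κ t)]
    (hreal : ∀ (t : ℝ≥0) (x : GaugeConfig 3 L (Matrix.specialUnitaryGroup (Fin 2) ℂ))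
        (Ω : Type) [MeasurableSpace Ω] (P : Measure Ω) [IsProbabilityMeasure P]
        (W : ℝ≥0 → Ω → (Edge 3 L × NoiseIdx 2 → ℝ)) (hW : IsFlatBrownian W P)
        (U : ℝ≥0 → Ω → GaugeConfig 3 L (Matrix.specialUnitaryGroup (Fin 2) ℂ)),
        (∀ ω, U 0 ω = x) →
        (latticeLangevinDynamics (fundamentalLatticeRep 2) β').IsSolution (fundamentalRep (Fin 2))
          hW.natFiltration P W U →
        κ t x = P.map (U t))
    {t : ℝ≥0} (ht : 0 < (t : ℝ)) :
    szzWassersteinSq (fun U U' : GaugeConfig 3 L (Matrix.specialUnitaryGroup (Fin 2) ℂ) => weightedRiemannDistSq (fundamentalLatticeRep 2) a (Literature.MathematicalPhysics.QuantumLattice.torusLift L U) (Literature.MathematicalPhysics.QuantumLattice.torusLift L U')) (κ t Q) (wilsonMeasure (d := 3) (L := L) (fundamentalRep (Fin 2)) β') ≤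
      ENNReal.ofReal (Real.exp (-(2 * (1 - (4 + 6 * ((Real.sqrt a ^ 2 + 1) / Real.sqrt a)) * |β'|) * (t : ℝ))) * (2 * Real.pi ^ 2 * ∑' et : Literature.MathematicalPhysics.QuantumLattice.ZdEdge 3, (a ^ edgeLevel et)⁻¹)) := by
  classical
  obtain ⟨w, hw⟩ : ∃ w : Edge 3 L → ℝ, w = fun e => (∑' et : {et : Literature.MathematicalPhysics.QuantumLattice.ZdEdge 3 // Literature.MathematicalPhysics.QuantumLattice.torusEdge L et = e}, (a ^ edgeLevel et.1)⁻¹) := ⟨_, rfl⟩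
  have hwpos : ∀ e, 0 < w e := fun e => by rw [hw]; exact torusWeight_pos ha e
  obtain ⟨e₀, he₀⟩ := Finite.exists_min w
  obtain ⟨e₁, he₁⟩ := Finite.exists_max w
  have hb : 1 ≤ Real.sqrt a := Real.one_le_sqrt.2 ha.le
  have hwb : ∀ (p : Plaquette 3 L) (e e' : Edge 3 L), e ∈ ({(p.1, p.2.1.1), (p.1.shift p.2.1.1, p.2.1.2), (p.1.shift p.2.1.2, p.2.1.1), (p.1, p.2.1.2)} : Finset (Edge 3 L)) → e' ∈ ({(p.1, p.2.1.1), (p.1.shift p.2.1.1, p.2.1.2), (p.1.shift p.2.1.2, p.2.1.1), (p.1, p.2.1.2)} : Finset (Edge 3 L)) → w e ≤ Real.sqrt a ^ 2 * w e' := by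
    intro p e e' he he'
    rw [Real.sq_sqrt (by linarith), hw]
    exact torusWeight_plaquette_le ha p e e' he he'
  have hcost : (fun U U' : GaugeConfig 3 L (Matrix.specialUnitaryGroup (Fin 2) ℂ) => weightedRiemannDistSq (fundamentalLatticeRep 2) a (Literature.MathematicalPhysics.QuantumLattice.torusLift L U) (Literature.MathematicalPhysics.QuantumLattice.torusLift L U')) = (fun U U' : GaugeConfig 3 L (Matrix.specialUnitaryGroup (Fin 2) ℂ) => (∑ e : Edge 3 L, w e * (fundamentalLatticeRep 2).riemannDist (U e) (U' e) ^ 2)) := by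
    funext U U'; rw [hw]; exact weightedRiemannDistSq_torusLift_eq (fundamentalLatticeRep 2) ha U U'
  have hsum : ∑ e : Edge 3 L, w e = ∑' et : Literature.MathematicalPhysics.QuantumLattice.ZdEdge 3, (a ^ edgeLevel et)⁻¹ := by rw [hw]; exact sum_torusWeight_eq_tsum ha
  rw [hcost, ← hsum]
  exact wilson_szzWasserstein_wW2_convergence_dirac L Q β' (Real.sqrt a) hb hβ w (hwpos e₀) he₀ he₁ hwb κ hreal ht

end Summit.QuantumFields.YangMills.Theorems.ColdStartUniversality
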